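import Summits.CriticalPhenomena.PercolationContinuityZ3.Theorems.PercNearOneGluingNoHeavyLowerTailSunflowerChainCertificateChecker
import HarnessLib

/-!
# `NoHeavyLowerTail` (crux stmt-CriticalPhenomena-4575), chain certificates — COMPILED CHECK, generic pattern, cell prefixes `[0,1]`, `[0,2]`, `[1,1]`, `[1,2]`, `[2,2]`

Support file (seat `prim-ineq-prove-1` gen 33; `--supports stmt-CriticalPhenomena-4575`, `--computational`: compiled evaluation by `native_decide`, axioms =
standard + `Lean.ofReduceBool`, confined to the theorems of this file).  Part of the kernel replay of `ChainCert.ThreeBlockMedianCertificate`; soundness of the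
checker: …ChainCertificateSound/…Final; timings: run/shared/lean/prim/prim-ineq-prove-1/FINDING-CHAINCERT-prove1-g33.md §4f–g.
EXPECTED elaboration: < 1 min (these prefixes carry a small fraction of the generic configurations).
-/

namespace Summit.CriticalPhenomena.PercolationContinuityZ3.Theorems.SunflowerPartition

namespace ChainCert

/-- Generic pattern, cell prefix `[0, 1]` (compiled evaluation). [this work] -/
theorem check_gen01 : checkPatternFrom bgen [0, 1] = true := by
  native_decide

/-- Generic pattern, cell prefix `[0, 2]` (compiled evaluation). [this work] -/
theorem check_gen02 : checkPatternFrom bgen [0, 2] = true := by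
  native_decide

/-- Generic pattern, cell prefix `[1, 1]` (compiled evaluation). [this work] -/
theorem check_gen11 : checkPatternFrom bgen [1, 1] = true := by
  native_decide

/-- Generic pattern, cell prefix `[1, 2]` (compiled evaluation). [this work] -/
theorem check_gen12 : checkPatternFrom bgen [1, 2] = true := by
  native_decide

/-- Generic pattern, cell prefix `[2, 2]` (compiled evaluation). [this work] -/
theorem check_gen22 : checkPatternFrom bgen [2, 2] = true := by
  native_decide


end ChainCert

end Summit.CriticalPhenomena.PercolationContinuityZ3.Theorems.SunflowerPartition
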